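import Literature.NumberTheory.LFunctions.ThetaChainFreeCheck
import HarnessLib

/-!
# Schoenfeld's `θ`-bound on `[599, 10⁸]` by kernel computation: data-free run, chunk 33 of 35

Topic: `Literature/NumberTheory/LFunctions`. Pure proof file (a kernel computation; nothing is
asserted, no definition). The theorems below evaluate `ThetaChain.runFree` — together `150000`
data-free steps of the certified `θ`-chain (`ThetaChain.stepFree`, `ThetaChainFreeCheck.lean`: the
next prime found and certified by two gcds with the primorials of the odd primes `≤ 2999` and in
`(2999, 10007]`, the enclosures of `log p` and `θ(p)`, and the two comparisons behind
`|θ(x) − x| ≤ √x log² x/(8π)`) — from the state at the prime `93269459` to the state at the prime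
`96021463`. Soundness: `ThetaChain.runFree_sound`; assembly of the 35 chunks: `ThetaUpTo1e8.lean`.
The expected states were obtained by evaluating a twin of the same function outside the kernel
(validated bit-for-bit on the tree's chunk `ThetaChainRun.xrun14`). Declarations of `5·10⁴` steps
(about `70 s` of kernel time each; the kernel's evaluation is linear within a declaration of this size),
`decide +kernel`, standard axioms only (`maxHeartbeats 0` lifts the deterministic time-out).

## References

* L. Schoenfeld, *Sharper bounds for the Chebyshev functions θ(x) and ψ(x). II*, Math. Comp. 30
  (1976), 337–360, Thm. 10 (6.3). [Schoenfeld1976]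
* J. B. Rosser, L. Schoenfeld, *Approximate formulas for some functions of prime numbers*,
  Illinois J. Math. 6 (1962), 64–94, Thms. 18–19 (`θ`-tables to `10⁸`). [RosserSchoenfeld1962]
-/

namespace Literature.NumberTheory.LFunctions.ThetaChainRun

open ThetaChain

set_option maxHeartbeats 0 in
/-- **Data-free certified `θ`-run, chunk 33a** (steps `4800001`–`4850000` after `8886113`: 50000 primes,
`93269459` to `94187339`). [cite: Schoenfeld1976, Thm. 10 (6.3)] -/
theorem frun33a :
    runFree 50000
      ⟨93269459, 22185001669324154276314556, 22185001669324629989009788, 112739947051304655916955639127839, 112739947051307222269437661329333⟩ =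
    some ⟨94187339, 22196840745969427437235251, 22196840745969903150880538, 113849493608720249283629868093902, 113849493608722839421770403992161⟩ := by
  decide +kernel

set_option maxHeartbeats 0 in
/-- **Data-free certified `θ`-run, chunk 33b** (steps `4850001`–`4900000` after `8886113`: 50000 primes,
`94187339` to `95103667`). [cite: Schoenfeld1976, Thm. 10 (6.3)] -/
theorem frun33b :
    runFree 50000
      ⟨94187339, 22196840745969427437235251, 22196840745969903150880538, 113849493608720249283629868093902, 113849493608722839421770403992161⟩ =
    some ⟨95103667, 22208545277051578444489198, 22208545277052054159084545, 114959628833206731934026746349594, 114959628833209345857873298456248⟩ := by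
  decide +kernel

set_option maxHeartbeats 0 in
/-- **Data-free certified `θ`-run, chunk 33c** (steps `4900001`–`4950000` after `8886113`: 50000 primes,
`95103667` to `96021463`). [cite: Schoenfeld1976, Thm. 10 (6.3)] -/
theorem frun33c :
    runFree 50000
      ⟨95103667, 22208545277051578444489198, 22208545277052054159084545, 114959628833206731934026746349594, 114959628833209345857873298456248⟩ =
    some ⟨96021463, 22220156055920130977188593, 22220156055920606692734025, 116070346793115026184362392210834, 116070346793117663893962463948133⟩ := by
  decide +kernel

end Literature.NumberTheory.LFunctions.ThetaChainRun
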